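import Summits.ResolutionOfSingularities.ResolutionOfSingularities.Theorems.PAlterationPicoverOfValuative
import Summits.ResolutionOfSingularities.ResolutionOfSingularities.Theorems.PAlterationPicoverOfSummit
import Summits.ResolutionOfSingularities.ResolutionOfSingularities.Theorems.PAlterationPicoverLocalModelToLuAlphaPTorsor
import Summits.ResolutionOfSingularities.ResolutionOfSingularities.Theses.WeightedInvariant
import Summits.ResolutionOfSingularities.ResolutionOfSingularities.Theorems.WeightedInvariantDatumToResolution
import Summits.ResolutionOfSingularities.ResolutionOfSingularities.Theorems.WeightedInvariantWeightedThesisGlue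
import Summits.ResolutionOfSingularities.ResolutionOfSingularities.Theses.Descent
import Summits.ResolutionOfSingularities.ResolutionOfSingularities.Theses.CyclicCovers
import Summits.ResolutionOfSingularities.ResolutionOfSingularities.Theses.UniformComplexity

/-!
# Crux `Picover` (stmt-ResolutionOfSingularities-0554): the crux map — what implies `Picover`, by name

Route `ResolutionOfSingularities/pAlteration`, crux
`Summit.ResolutionOfSingularities.ResolutionOfSingularities.Theses.PAlteration.Picover` (lead c1).
Companion of the landed edges `OfSummit.picover_of_resolutionOfSingularities` (summit ⟹ Picover),
`OfValuative.picover_of_valuative` (Valuative's three cruxes ⟹ Picover) and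
`Theorems.luAlphaPTorsor_of_picoverLocalModel` (rank 5 ⟹ Valuative's
`LuAlphaPTorsor`). This file completes the BY-NAME map of implications INTO the crux from the other
routes of the summit, so that planners re-lining `Picover` see every formal dependency:

* `picover_of_picoverLocalModel_torsorToLurel_patchingRel` (registered sub-goal): **rank 5 of
  pAlteration + Valuative's two gluing cruxes ⟹ rank 2** —
  `PicoverLocalModel → TorsorToLurel → PatchingRel → Picover`. Together with the landed
  `Picover ⟹ PicoverLocalModel` (`IffDegP.picoverLocalModel_of_picover`) and
  `PicoverLocalModel ⟺ affine residue` (this seat / lead 1), this is the formal content of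
  "the gap between 0557 and 0554 is gluing": Temkin's Frobenius transport `TorsorToLurel` plus
  Zariski patching `PatchingRel` close it.
* `picover_of_cyclicCovers`: route CyclicCovers' five cruxes ⟹ Picover; and since its
  `LuAlphaPTorsor` is Valuative's verbatim (`cyclicCovers_luAlphaPTorsor_iff`), also
  `PicoverLocalModel → AsAscentRel → EluRegular → AbhyankarReduction → PatchingRel → Picover`
  (`picover_of_picoverLocalModel_cyclicCovers`).
* `picover_of_weightedInvariant`, `picover_of_descent`, `picover_of_uniformComplexity`: the
  deciding hypotheses of the three other routes ⟹ Picover (through the summit).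
* `picoverPerfect_of_weightedThesis`: over PERFECT ground fields the crux is dominated by
  `WeightedThesis` alone (resolution over perfect fields), with no descent step.

All proofs are composition of landed theorems and the routes' deciding theorems `closes`
(pure logic). No new definitions.
-/

set_option linter.dupNamespace false -- mandated namespace of this single-conjunct summit

open CategoryTheory AlgebraicGeometry
open Summit.ResolutionOfSingularities.ResolutionOfSingularities

namespace Summit.ResolutionOfSingularities.ResolutionOfSingularities.Theorems.Picover.CruxMap

/-- **Rank 5 + Valuative's gluing ⟹ rank 2** (registered sub-goal): the local model
`PicoverLocalModel` gives `Valuative.LuAlphaPTorsor` (landed `luAlphaPTorsor_of_picoverLocalModel`),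
and `LuAlphaPTorsor → TorsorToLurel → PatchingRel → Picover` is the landed `picover_of_valuative`.
[folklore] -/
theorem picover_of_picoverLocalModel_torsorToLurel_patchingRel : Summit.ResolutionOfSingularities.ResolutionOfSingularities.Theses.PAlteration.PicoverLocalModel → Summit.ResolutionOfSingularities.ResolutionOfSingularities.Theses.Valuative.TorsorToLurel → Summit.ResolutionOfSingularities.ResolutionOfSingularities.Theses.Valuative.PatchingRel → Summit.ResolutionOfSingularities.ResolutionOfSingularities.Theses.PAlteration.Picover :=
  fun hLM h₄ h₃ => OfValuative.picover_of_valuative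
    (Theorems.luAlphaPTorsor_of_picoverLocalModel hLM) h₄ h₃

/-- Route CyclicCovers' `LuAlphaPTorsor` is route Valuative's, verbatim (item stmt-0641 shared).
[folklore] -/
theorem cyclicCovers_luAlphaPTorsor_iff :
    Theses.CyclicCovers.LuAlphaPTorsor ↔ Theses.Valuative.LuAlphaPTorsor := Iff.rfl

/-- Route CyclicCovers' `PatchingRel` is route Valuative's, verbatim (item stmt-0642 shared).
[folklore] -/
theorem cyclicCovers_patchingRel_iff :
    Theses.CyclicCovers.PatchingRel ↔ Theses.Valuative.PatchingRel := Iff.rfl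

/-- **Route CyclicCovers' cruxes ⟹ Picover**: Abhyankar's relative strategy
(`AsAscentRel`, `LuAlphaPTorsor`, `EluRegular`, `AbhyankarReduction`, `PatchingRel`) gives the
summit (`CyclicCovers.closes`), which gives the crux (`picover_of_resolutionOfSingularities`).
[folklore] -/
theorem picover_of_cyclicCovers : Theses.CyclicCovers.AsAscentRel → Theses.CyclicCovers.LuAlphaPTorsor → Theses.CyclicCovers.EluRegular → Theses.CyclicCovers.AbhyankarReduction → Theses.CyclicCovers.PatchingRel → Theses.PAlteration.Picover :=
  fun hAS hPI hElu hRed hPatch => OfSummit.picover_of_resolutionOfSingularities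
    (Theses.CyclicCovers.closes hAS hPI hElu hRed hPatch)

/-- **Rank 5 + CyclicCovers' remaining cruxes ⟹ rank 2**: the local model supplies the shared
purely inseparable step `LuAlphaPTorsor`. [folklore] -/
theorem picover_of_picoverLocalModel_cyclicCovers : Theses.PAlteration.PicoverLocalModel → Theses.CyclicCovers.AsAscentRel → Theses.CyclicCovers.EluRegular → Theses.CyclicCovers.AbhyankarReduction → Theses.CyclicCovers.PatchingRel → Theses.PAlteration.Picover :=
  fun hLM hAS hElu hRed hPatch => picover_of_cyclicCovers hAS
    (cyclicCovers_luAlphaPTorsor_iff.mpr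
      (Theorems.luAlphaPTorsor_of_picoverLocalModel hLM)) hElu hRed hPatch

/-- **Route WeightedInvariant's deciding hypotheses ⟹ Picover** (weighted datum, embedded ⟹
non-embedded, descent from perfect fields; through `WeightedInvariant.closes` and the summit).
[folklore] -/
theorem picover_of_weightedInvariant : Theses.WeightedInvariant.WeightedConstruction → Theses.WeightedInvariant.DatumToEmbedded → Theses.WeightedInvariant.DescentPerfectToAll → Theses.PAlteration.Picover :=
  -- buildfix (bf3-g25, 2026-08-27): route WeightedInvariant rev 21 (02:44Z) re-typed `closes` to the hypersurface door
  -- (HypersurfaceCentreConstruction / HypersurfaceCentreToResolution); the summit from THIS theorem's three hypotheses is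
  -- the landed tail `WeightedThesis.Glue.resolutionOfSingularities_of_items` with `DatumToResolution` derived from
  -- `DatumToEmbedded` (`datumToResolution_of_datumToEmbedded`); statement unchanged.
  fun hC hE hD => OfSummit.picover_of_resolutionOfSingularities
    (Theorems.WeightedThesis.Glue.resolutionOfSingularities_of_items hC
      (Theorems.datumToResolution_of_datumToEmbedded hE) hD)

/-- **Route Descent's deciding hypotheses ⟹ Picover** (resolution over algebraically closed
fields + the two descents; `DescentReducedToIntegral` is proved in the tree). [folklore] -/
theorem picover_of_descent : Theses.Descent.DescentThesis → Theses.Descent.DescentPerfectToAll → Theses.Descent.DescentAlgclosedToPerfect → Theses.PAlteration.Picover :=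
  fun hT hP hA => OfSummit.picover_of_resolutionOfSingularities
    (Theses.Descent.closes hT hP hA Theses.Descent.DescentReducedToIntegral_holds)

/-- **Route UniformComplexity's deciding hypotheses ⟹ Picover**. [folklore] -/
theorem picover_of_uniformComplexity : Theses.UniformComplexity.PrimeClosureThesis → Theses.UniformComplexity.PrimeModelTransfer → Theses.UniformComplexity.DescentAlgclosedToPerfect → Theses.UniformComplexity.DescentPerfectToAll → Theses.PAlteration.Picover :=
  fun hRB hPM hAP hPA => OfSummit.picover_of_resolutionOfSingularities
    (Theses.UniformComplexity.closes hRB hPM hAP hPA)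

/-- **Over perfect ground fields `Picover` is dominated by `WeightedThesis` alone**: resolution of
reduced separated finite-type schemes over perfect fields of characteristic `p` gives the crux for
every PERFECT `k` directly (a finite cover of a separated finite-type `k`-scheme is separated of
finite type; an integral scheme is reduced) — no descent step, and none of `IsRegular Y`,
`UniversallyInjective g`, `Surjective g` is used. [folklore] -/
theorem picoverPerfect_of_weightedThesis (hW : Theses.WeightedInvariant.WeightedThesis) :
    ∀ p : ℕ, p.Prime → ∀ (k : Type) [Field k] [CharP k p] [PerfectField k] (Y X : Scheme.{0})
      (f : Y ⟶ Spec (.of k)) (g : X ⟶ Y), IsSeparated f → LocallyOfFiniteType f →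
      QuasiCompact f → IsIntegral Y → Literature.AlgebraicGeometry.Resolution.Scheme.IsRegular Y →
      IsIntegral X → IsFinite g → UniversallyInjective g → Function.Surjective g.base →
      Literature.AlgebraicGeometry.Resolution.Scheme.HasResolution X := by
  intro p hp k _ _ _ Y X f g _ _ _ _ _ _ _ _ _
  haveI : IsSeparated (g ≫ f) := inferInstance
  haveI : LocallyOfFiniteType (g ≫ f) := inferInstance
  haveI : QuasiCompact (g ≫ f) := inferInstance
  exact hW p hp k X (g ≫ f) inferInstance inferInstance inferInstance inferInstance

end Summit.ResolutionOfSingularities.ResolutionOfSingularities.Theorems.Picover.CruxMap
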